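import Literature.NumberTheory.EllipticCurves.FunctionFieldEllipticL
import HarnessLib

/-!
# `Ш(E/F)` over a function field does not depend on the chosen embeddings `F̄ → F̄_v`

Discharge of the named fact
`Literature.NumberTheory.EllipticCurves.FunctionField.sha_eq_of_algHom` of the statement file
`Literature.NumberTheory.EllipticCurves.FunctionFieldEllipticL`: for a Weierstrass curve `W` over a
field `F` and ANY family of `F`-embeddings `ι_v : F̄ → F̄_v` (`v` running over the places of `F`,
`F_v = v.Completion`), the Tate–Shafarevich group `sha W = ⨅_v ker (H¹(F, E) → H¹(F_v, E))`
(defined with the canonical embeddings) equals `⨅_v W.localRestrictionKerOfEmb (ι_v)`.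

The statement file records (comment after the `def`) that its interim proof
`simp only [sha, WeierstrassCurve.localRestrictionKerOfEmb_eq]` was demoted when
`WeierstrassCurve.localRestrictionKerOfEmb_eq` became a named fact (D-0014). That fact has since
been PROVED in `Literature.NumberTheory.EllipticCurves.Sha`
(`WeierstrassCurve.localRestrictionKerOfEmb_eq_holds`: the restriction `H¹(F, E) → H¹(L, E)` does
not depend on the embedding of algebraic closures — Serre, *Galois Cohomology* II.§1.1, via
conjugation-invariance of group cohomology), which the statement file already imports; so the
discharge is the preserved proof with the theorem in place of the fact, place by place
(`iInf_congr`), exactly as the number-field twin `WeierstrassCurve.sha_eq_of_algHom_holds`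
(`ShaProofs`). No function-field structure is needed: the statement holds for every field `F`.

## References

* [SerreGaloisCohomology1997] J.-P. Serre, *Galois Cohomology*, Springer 1997, II.§1.1 (the maps
  on cohomology do not depend on the choice of the embedding).
* [SilvermanAEC2009] J. H. Silverman, *The Arithmetic of Elliptic Curves*, 2nd ed. 2009, X.§4
  Remark 4.1.1 (`Ш(E/K)` depends only on `E` and `K`).
* [Tate1966Bourbaki] J. Tate, *On the conjectures of Birch and Swinnerton-Dyer and a geometric
  analog*, Sém. Bourbaki 306 (1966), §1.
-/

namespace Literature.NumberTheory.EllipticCurves.FunctionField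

variable {F : Type} [Field F] (W : WeierstrassCurve F)

/-- **Discharge** of `sha_eq_of_algHom`: `Ш(E/F) = ⨅_v ker (H¹(F, E) → H¹(F_v, E))` computed with
any family of embeddings `ι_v : F̄ →ₐ[F] F̄_v` — each local kernel is independent of the embedding
(`WeierstrassCurve.localRestrictionKerOfEmb_eq_holds`, Serre *Galois Cohomology* II.§1.1), and
`sha W` is by definition the infimum over the canonical ones.
[cite: SerreGaloisCohomology1997, II.§1.1] [cite: SilvermanAEC2009, X.§4 Remark 4.1.1] -/
theorem sha_eq_of_algHom_holds : sha_eq_of_algHom W := by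
  intro ι
  have h : (⨅ v : Place F, W.localRestrictionKerOfEmb (ι v)) =
      ⨅ v : Place F, W.localRestrictionKer v.Completion :=
    iInf_congr fun v => WeierstrassCurve.localRestrictionKerOfEmb_eq_holds W v.Completion (ι v)
  rw [h]
  rfl

end Literature.NumberTheory.EllipticCurves.FunctionField
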